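import Literature.Computability.MetaComplexity.Resolution
import Literature.Computability.Complexity.E3InstanceMachine
import HarnessLib

/-!
# A polynomial-time checkable witness format for Resolution refutations

Soloist file (`solo-PneNP-informed`; landing prefix `SoloInformed`), first half of **`RESBOUND ∈ NP`**
(the routine half of [Atserias–Müller 2020, Thm 1]: refutations of length `s` can be guessed and
checked; Resolution is a Cook–Reckhow system [Cook–Reckhow 1979, Def. 1.4]). A refutation
`π : List (ResLine ℕ)` (`IsResRefutation`, `Resolution.lean`) is written as a CNF-shaped WITNESS
`W : CNF ℕ`, one clause-shaped code per line: four header literals `(tag,_) (i,_) (j,_) (v,_)` (tag `1`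
resolve `i j` on pivot `v`, `2` weakening of line `i`, else axiom) followed by the literals of the
clause — so the tree's total CNF decoder reads ANY string as a witness. Contents: the Boolean checker
`SoloResNP.refB F s W` with `refB F s W = true ↔ IsResRefutation F (W.map lineOf) ∧ |W| ≤ s`
(`refB_eq_true_iff`); the encoder `encLine` (`lineOf_encLine`); the projection of a refutation onto
the variables of `F` (`isResRefutation_map_proj`: foreign-pivot resolutions become weakenings). The
witness-length bound, the machine (`refB ∈ FP`) and `RESBOUND ∈ NP` follow in
`SoloInformedResBoundNP.lean`. Refs: A. Atserias, M. Müller, J. ACM 67(5) (2020) Art. 31,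
§1; S. A. Cook, R. A. Reckhow, J. Symb. Logic 44 (1979), Def. 1.4 [CookReckhow1979].
-/


namespace Summit.PneNP.PneNP.Theorems

open Literature.Computability.Complexity Literature.Computability.MetaComplexity
open _root_.Computability Literature.Computability.Complexity.CodeFP
open Literature.Computability.Complexity.Expander.E3LC (cnfE litE)

namespace SoloResNP

/-! ### Line codes -/

/-- Header field `k` of a line code: the variable of its `k`-th literal (`0` if absent). [folklore] -/
def hdr (c : Clause ℕ) (k : ℕ) : ℕ := (c.map Prod.fst).getD k 0

/-- The clause part of a line code: everything after the four header literals. [folklore] -/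
def body (c : Clause ℕ) : Clause ℕ := c.drop 4

/-- The rule named by a line code (tag `1` resolve, `2` weaken, anything else axiom).
[cite: CookReckhow1979, Def. 1.4 (proofs as checkable strings)] -/
def lineRule (c : Clause ℕ) : ResRule ℕ :=
  if hdr c 0 = 1 then ResRule.resolve (hdr c 1) (hdr c 2) (hdr c 3)
  else if hdr c 0 = 2 then ResRule.weaken (hdr c 1) else ResRule.initial

/-- The resolution line read off a line code. [cite: CookReckhow1979, Def. 1.4] -/
def lineOf (c : Clause ℕ) : ResLine ℕ := ⟨(body c).toFinset, lineRule c⟩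

/-- The header of a rule. [folklore] -/
def hdrOf : ResRule ℕ → Clause ℕ
  | ResRule.initial => [(0, false), (0, false), (0, false), (0, false)]
  | ResRule.resolve i j v => [(1, false), (i, false), (j, false), (v, false)]
  | ResRule.weaken i => [(2, false), (i, false), (0, false), (0, false)]

/-- The line code of a resolution line: header, then the literals of the clause. [folklore] -/
noncomputable def encLine (l : ResLine ℕ) : Clause ℕ := hdrOf l.rule ++ l.clause.toList

/-- The header has four literals. [folklore] -/
theorem length_hdrOf (r : ResRule ℕ) : (hdrOf r).length = 4 := by cases r <;> rfl

/-- Decoding inverts encoding of lines. [folklore] -/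
theorem lineOf_encLine (l : ResLine ℕ) : lineOf (encLine l) = l := by
  obtain ⟨C, r⟩ := l
  have hb : body (encLine ⟨C, r⟩) = C.toList := by
    simp only [body, encLine]
    rw [List.drop_append_of_le_length (by rw [length_hdrOf]), List.drop_eq_nil_of_le (by rw [length_hdrOf])]
    rfl
  have hr : lineRule (encLine ⟨C, r⟩) = r := by
    cases r <;> simp [lineRule, hdr, encLine, hdrOf]
  rw [lineOf, hb, hr, Finset.toList_toFinset]

/-! ### The Boolean checker -/

/-- `c ⊆ d` as sets of literals. [folklore] -/
def subB (c d : Clause ℕ) : Bool := c.all fun l => decide (l ∈ d)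

/-- The list form of the resolvent `(C ∖ {v}) ∪ (D ∖ {¬v})`. [cite: BenSassonWigderson2001, §2.1] -/
def resStep (C D : Clause ℕ) (v : ℕ) : Clause ℕ :=
  C.filter (fun l => !decide (l = (v, true))) ++ D.filter (fun l => !decide (l = (v, false)))

/-- Check of an axiom line: its clause is (as a set) a clause of `F`. [cite: CookReckhow1979, Def. 1.4] -/
def initB (F : CNF ℕ) (c : Clause ℕ) : Bool := F.any fun C => subB C (body c) && subB (body c) C

/-- Check of a weakening line. [cite: CookReckhow1979, Def. 1.4] -/
def weakB (prev : CNF ℕ) (c : Clause ℕ) : Bool :=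
  decide (hdr c 1 < prev.length) && subB (body (prev.getD (hdr c 1) [])) (body c)

/-- Check of a resolution line. [cite: CookReckhow1979, Def. 1.4] -/
def resB (prev : CNF ℕ) (c : Clause ℕ) : Bool :=
  decide (hdr c 1 < prev.length) && (decide (hdr c 2 < prev.length) &&
    (decide ((hdr c 3, true) ∈ body (prev.getD (hdr c 1) [])) &&
      (decide ((hdr c 3, false) ∈ body (prev.getD (hdr c 2) [])) &&
        (subB (body c) (resStep (body (prev.getD (hdr c 1) [])) (body (prev.getD (hdr c 2) [])) (hdr c 3)) &&
          subB (resStep (body (prev.getD (hdr c 1) [])) (body (prev.getD (hdr c 2) [])) (hdr c 3)) (body c)))))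

/-- Check of one line against the previous lines. [cite: CookReckhow1979, Def. 1.4] -/
def validB (F prev : CNF ℕ) (c : Clause ℕ) : Bool :=
  if hdr c 0 = 1 then resB prev c else if hdr c 0 = 2 then weakB prev c else initB F c

/-- Check of a derivation: every line against its predecessors. [cite: CookReckhow1979, Def. 1.4] -/
def derivB (F W : CNF ℕ) : Bool :=
  ((List.range W.length).zip W).all fun kc => validB F (W.take kc.1) kc.2

/-- **The checker**: `W` codes a refutation of `F` with at most `s` lines.
[cite: AtseriasMuller2020, §1 (refutations of length s can be checked)] -/
def refB (F : CNF ℕ) (s : ℕ) (W : CNF ℕ) : Bool :=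
  decide (W.length ≤ s) && (derivB F W && W.any fun c => (body c).isEmpty)

/-! ### Specification of the checker -/

/-- `subB` decides containment of the underlying literal sets. [folklore] -/
theorem subB_eq_true_iff (c d : Clause ℕ) : subB c d = true ↔ c.toFinset ⊆ d.toFinset := by
  simp [subB, List.all_eq_true, Finset.subset_iff]

/-- Mutual `subB` decides equality of the underlying literal sets. [folklore] -/
theorem subB_and_subB_eq_true_iff (c d : Clause ℕ) :
    (subB c d && subB d c) = true ↔ c.toFinset = d.toFinset := by
  rw [Bool.and_eq_true, subB_eq_true_iff, subB_eq_true_iff]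
  exact Finset.Subset.antisymm_iff.symm

/-- The literal set of `resStep C D v` is the resolvent set `(C − x_v) ∪ (D − ¬x_v)`. [folklore] -/
theorem toFinset_resStep (C D : Clause ℕ) (v : ℕ) :
    (resStep C D v).toFinset = C.toFinset.erase (v, true) ∪ D.toFinset.erase (v, false) := by
  ext l
  simp only [resStep, List.toFinset_append, Finset.mem_union, List.mem_toFinset, List.mem_filter,
    Bool.not_eq_true', decide_eq_false_iff_not, Finset.mem_erase]
  tauto

/-- In range, `getD` is the indexed element. [folklore] -/
theorem getD_eq_getElem_of_lt {prev : CNF ℕ} {i : ℕ} (hi : i < prev.length) :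
    prev.getD i [] = prev[i] := by
  rw [List.getD_eq_getElem?_getD, List.getElem?_eq_getElem hi, Option.getD_some]

/-- The line check is the tree's `IsValidResLine` on the decoded lines. [cite: CookReckhow1979, Def. 1.4] -/
theorem validB_eq_true_iff (F prev : CNF ℕ) (c : Clause ℕ) :
    validB F prev c = true ↔ IsValidResLine F (prev.map lineOf) (lineOf c) := by
  have hlen : (prev.map lineOf).length = prev.length := List.length_map _
  have hget : ∀ {i : ℕ} (hi : i < prev.length) (hi' : i < (prev.map lineOf).length),
      ((prev.map lineOf)[i]'hi').clause = (body (prev.getD i [])).toFinset := by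
    intro i hi hi'
    simp only [List.getElem_map]
    rw [getD_eq_getElem_of_lt hi]; rfl
  by_cases h1 : hdr c 0 = 1
  · have hl : lineOf c = ⟨(body c).toFinset, ResRule.resolve (hdr c 1) (hdr c 2) (hdr c 3)⟩ := by
      simp only [lineOf, lineRule, if_pos h1]
    rw [hl, validB, if_pos h1]
    show resB prev c = true ↔ ∃ (hi : hdr c 1 < (prev.map lineOf).length) (hj : hdr c 2 < (prev.map lineOf).length),
      (hdr c 3, true) ∈ ((prev.map lineOf)[hdr c 1]).clause ∧ (hdr c 3, false) ∈ ((prev.map lineOf)[hdr c 2]).clause ∧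
        (body c).toFinset = ((prev.map lineOf)[hdr c 1]).clause.erase (hdr c 3, true) ∪
          ((prev.map lineOf)[hdr c 2]).clause.erase (hdr c 3, false)
    constructor
    · intro h
      simp only [resB, Bool.and_eq_true, decide_eq_true_iff] at h
      obtain ⟨hi, hj, hv1, hv2, hs1, hs2⟩ := h
      refine ⟨hlen ▸ hi, hlen ▸ hj, ?_⟩
      rw [hget hi, hget hj, List.mem_toFinset, List.mem_toFinset, ← toFinset_resStep]
      exact ⟨hv1, hv2, (subB_and_subB_eq_true_iff _ _).1 (by rw [hs1, hs2]; rfl)⟩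
    · rintro ⟨hi', hj', h⟩
      have hi : hdr c 1 < prev.length := hlen ▸ hi'
      have hj : hdr c 2 < prev.length := hlen ▸ hj'
      rw [hget hi, hget hj, List.mem_toFinset, List.mem_toFinset, ← toFinset_resStep] at h
      obtain ⟨hv1, hv2, hE⟩ := h
      have hs := (subB_and_subB_eq_true_iff _ _).2 hE
      rw [Bool.and_eq_true] at hs
      simp only [resB, Bool.and_eq_true, decide_eq_true_iff]
      exact ⟨hi, hj, hv1, hv2, hs.1, hs.2⟩
  · by_cases h2 : hdr c 0 = 2
    · have hl : lineOf c = ⟨(body c).toFinset, ResRule.weaken (hdr c 1)⟩ := by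
        simp only [lineOf, lineRule, if_neg h1, if_pos h2]
      rw [hl, validB, if_neg h1, if_pos h2]
      show weakB prev c = true ↔ ∃ hi : hdr c 1 < (prev.map lineOf).length,
        ((prev.map lineOf)[hdr c 1]).clause ⊆ (body c).toFinset
      rw [weakB, Bool.and_eq_true, decide_eq_true_iff, subB_eq_true_iff]
      constructor
      · rintro ⟨hi, hs⟩
        exact ⟨hlen ▸ hi, by rw [hget hi]; exact hs⟩
      · rintro ⟨hi', hs⟩
        have hi : hdr c 1 < prev.length := hlen ▸ hi'
        exact ⟨hi, by rw [← hget hi hi']; exact hs⟩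
    · have hl : lineOf c = ⟨(body c).toFinset, ResRule.initial⟩ := by
        simp only [lineOf, lineRule, if_neg h1, if_neg h2]
      rw [hl, validB, if_neg h1, if_neg h2]
      show initB F c = true ↔ (body c).toFinset ∈ F.clauseFinsets
      rw [initB, List.any_eq_true, CNF.clauseFinsets, List.mem_map]
      simp only [subB_and_subB_eq_true_iff]

/-- Membership in the enumeration `(range |W|).zip W` is an in-range index equation. [folklore] -/
theorem mem_zip_range_iff {α : Type} (W : List α) (k : ℕ) (c : α) :
    (k, c) ∈ (List.range W.length).zip W ↔ ∃ hk : k < W.length, W[k] = c := by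
  rw [List.mem_iff_getElem]
  constructor
  · rintro ⟨i, hi, h⟩
    rw [List.getElem_zip, Prod.mk.injEq, List.getElem_range] at h
    obtain ⟨rfl, rfl⟩ := h
    rw [List.length_zip, List.length_range, min_self] at hi
    exact ⟨hi, rfl⟩
  · rintro ⟨hk, rfl⟩
    refine ⟨k, by rw [List.length_zip, List.length_range, min_self]; exact hk, ?_⟩
    rw [List.getElem_zip, List.getElem_range]

/-- The derivation check is the tree's `IsResDerivation` on the decoded lines. [cite: CookReckhow1979, Def. 1.4] -/
theorem derivB_eq_true_iff (F W : CNF ℕ) : derivB F W = true ↔ IsResDerivation F (W.map lineOf) := by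
  rw [derivB, List.all_eq_true]
  constructor
  · intro h k hk
    rw [List.length_map] at hk
    have hv := h (k, W[k]) ((mem_zip_range_iff W k _).2 ⟨hk, rfl⟩)
    rw [validB_eq_true_iff, List.map_take] at hv
    simp only [List.getElem_map]
    exact hv
  · rintro h ⟨k, c⟩ hkc
    obtain ⟨hk, rfl⟩ := (mem_zip_range_iff W k c).1 hkc
    have hv := h k (by rw [List.length_map]; exact hk)
    simp only [List.getElem_map] at hv
    rw [← List.map_take] at hv
    exact (validB_eq_true_iff _ _ _).2 hv

/-- **Specification of the checker.** [cite: AtseriasMuller2020, §1; CookReckhow1979, Def. 1.4] -/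
theorem refB_eq_true_iff (F : CNF ℕ) (s : ℕ) (W : CNF ℕ) :
    refB F s W = true ↔ IsResRefutation F (W.map lineOf) ∧ W.length ≤ s := by
  simp only [refB, Bool.and_eq_true, decide_eq_true_iff, derivB_eq_true_iff, IsResRefutation,
    List.any_eq_true, List.mem_map, List.isEmpty_iff]
  constructor
  · rintro ⟨hs, hd, c, hc, he⟩
    exact ⟨⟨hd, lineOf c, ⟨c, hc, rfl⟩, by rw [lineOf, he]; rfl⟩, hs⟩
  · rintro ⟨⟨hd, l, ⟨c, hc, rfl⟩, he⟩, hs⟩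
    refine ⟨hs, hd, c, hc, ?_⟩
    have he' : (body c).toFinset = ∅ := he
    exact List.toFinset_eq_empty_iff _ |>.1 he'

/-- The checker accepts the code of a refutation. [cite: CookReckhow1979, Def. 1.4] -/
theorem refB_map_encLine {F : CNF ℕ} {s : ℕ} {π : List (ResLine ℕ)} (hπ : IsResRefutation F π)
    (hs : π.length ≤ s) : refB F s (π.map encLine) = true := by
  rw [refB_eq_true_iff, List.map_map, List.length_map]
  have : lineOf ∘ encLine = id := funext lineOf_encLine
  rw [this, List.map_id]
  exact ⟨hπ, hs⟩

/-! ### Projection of a refutation onto the variables of the formula -/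

/-- The literals of `C` on variables of `F`. [folklore] -/
def projC (F : CNF ℕ) (C : Finset (Literal ℕ)) : Finset (Literal ℕ) := C.filter fun l => l.1 ∈ F.vars

/-- Rules under projection: a resolution on a foreign pivot becomes a weakening. [folklore] -/
def projR (F : CNF ℕ) : ResRule ℕ → ResRule ℕ
  | ResRule.resolve i j v => if v ∈ F.vars then ResRule.resolve i j v else ResRule.weaken i
  | r => r

/-- Lines under projection. [folklore] -/
def projL (F : CNF ℕ) (l : ResLine ℕ) : ResLine ℕ := ⟨projC F l.clause, projR F l.rule⟩

/-- The variable of a literal of a clause of `F` is a variable of `F`. [folklore] -/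
theorem mem_vars_of_mem {F : CNF ℕ} {c : Clause ℕ} (hc : c ∈ F) {l : Literal ℕ} (hl : l ∈ c) :
    l.1 ∈ F.vars := by
  simp only [CNF.vars, List.mem_toFinset, List.mem_map, List.mem_flatten]
  exact ⟨l, ⟨c, hc, hl⟩, rfl⟩

/-- Clauses of `F` are fixed by the projection onto the variables of `F`. [folklore] -/
theorem projC_eq_self_of_mem {F : CNF ℕ} {C : Finset (Literal ℕ)} (hC : C ∈ F.clauseFinsets) :
    projC F C = C := by
  obtain ⟨c, hc, rfl⟩ := List.mem_map.1 hC
  exact Finset.filter_true_of_mem fun l hl => mem_vars_of_mem hc (List.mem_toFinset.1 hl)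

/-- **Projection preserves derivations.** [cite: BenSassonWigderson2001, §3 (restrictions of refutations)] -/
theorem isResDerivation_map_proj {F : CNF ℕ} {π : List (ResLine ℕ)} (hπ : IsResDerivation F π) :
    IsResDerivation F (π.map (projL F)) := by
  intro k hk
  rw [List.length_map] at hk
  have hv := hπ k hk
  rw [List.getElem_map, ← List.map_take]
  generalize (π.take k) = prev at hv ⊢
  generalize π[k] = l at hv ⊢
  obtain ⟨C, r⟩ := l
  cases r with
  | initial =>
    have hv' : C ∈ F.clauseFinsets := hv
    show projC F C ∈ F.clauseFinsets
    rw [projC_eq_self_of_mem hv']; exact hv'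
  | weaken i =>
    have hv' : ∃ hi : i < prev.length, (prev[i]).clause ⊆ C := hv
    obtain ⟨hi, hs⟩ := hv'
    show ∃ hi' : i < (prev.map (projL F)).length, ((prev.map (projL F))[i]).clause ⊆ projC F C
    refine ⟨by rw [List.length_map]; exact hi, ?_⟩
    simp only [List.getElem_map]
    exact Finset.filter_subset_filter _ hs
  | resolve i j v =>
    have hv' : ∃ (hi : i < prev.length) (hj : j < prev.length), (v, true) ∈ (prev[i]).clause ∧
        (v, false) ∈ (prev[j]).clause ∧ C = (prev[i]).clause.erase (v, true) ∪ (prev[j]).clause.erase (v, false) := hv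
    obtain ⟨hi, hj, h1, h2, hE⟩ := hv'
    have hiP : i < (prev.map (projL F)).length := by rw [List.length_map]; exact hi
    have hjP : j < (prev.map (projL F)).length := by rw [List.length_map]; exact hj
    by_cases hvar : v ∈ F.vars
    · have hr : projL F ⟨C, ResRule.resolve i j v⟩ = ⟨projC F C, ResRule.resolve i j v⟩ := by
        simp only [projL, projR, if_pos hvar]
      rw [hr]
      show ∃ (hi' : i < (prev.map (projL F)).length) (hj' : j < (prev.map (projL F)).length),
        (v, true) ∈ ((prev.map (projL F))[i]).clause ∧ (v, false) ∈ ((prev.map (projL F))[j]).clause ∧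
          projC F C = ((prev.map (projL F))[i]).clause.erase (v, true) ∪ ((prev.map (projL F))[j]).clause.erase (v, false)
      refine ⟨hiP, hjP, ?_⟩
      simp only [List.getElem_map]
      refine ⟨Finset.mem_filter.2 ⟨h1, hvar⟩, Finset.mem_filter.2 ⟨h2, hvar⟩, ?_⟩
      rw [hE]
      ext l
      simp only [projL, projC, Finset.mem_filter, Finset.mem_union, Finset.mem_erase]
      tauto
    · have hr : projL F ⟨C, ResRule.resolve i j v⟩ = ⟨projC F C, ResRule.weaken i⟩ := by
        simp only [projL, projR, if_neg hvar]
      rw [hr]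
      show ∃ hi' : i < (prev.map (projL F)).length, ((prev.map (projL F))[i]).clause ⊆ projC F C
      refine ⟨hiP, ?_⟩
      simp only [List.getElem_map]
      intro l hl
      obtain ⟨hlC, hlv⟩ := Finset.mem_filter.1 hl
      refine Finset.mem_filter.2 ⟨?_, hlv⟩
      rw [hE]
      refine Finset.mem_union_left _ (Finset.mem_erase.2 ⟨?_, hlC⟩)
      rintro rfl
      exact hvar hlv

/-- **Projection preserves refutations** (same length). [cite: BenSassonWigderson2001, §3] -/
theorem isResRefutation_map_proj {F : CNF ℕ} {π : List (ResLine ℕ)} (hπ : IsResRefutation F π) :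
    IsResRefutation F (π.map (projL F)) := by
  refine ⟨isResDerivation_map_proj hπ.1, ?_⟩
  obtain ⟨l, hl, he⟩ := hπ.2
  refine ⟨projL F l, List.mem_map.2 ⟨l, hl, rfl⟩, ?_⟩
  show projC F l.clause = ∅
  rw [he]; rfl

end SoloResNP

end Summit.PneNP.PneNP.Theorems
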